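import Summits.ABC.IUTFork.Joshi.TestDictionaryCalibration
import Summits.ABC.IUTFork.Thm311SigProofs
import Mathlib.RingTheory.PiTensorProduct
import HarnessLib

/-!
# Branch E TEST vs S — the dictionary calibration ACROSS PLACES: S as typed is packet-local

Record file of the abc-iut cell, branch E (rung LADDER-ABC:A2.E; seat abc-iut-E-t42 gen 2, row T-42c «MULTI-PLACE CALIBRATION»,
AUTHORS-FIRST sequel of the seat's own `Joshi/TestDictionaryCalibration.lean` p430744). **No side is taken** on [IUTchIII] Cor. 3.12
or on any author (Mochizuki / Scholze–Stix / Joshi); Joshi's papers (arXiv:2401.13508v4 …) are unrefereed preprints cited as such;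
typed ≠ proved; interface/toy level where models are used; located, not adjudicated.

THE QUESTION. p430744 proved, under PR-1's equivariance (hρ), `DictionaryRealizable ⟺ UniformIndRelated ⟹ S` at every index and
`S ⟹ UniformIndRelated` at ONE place (`[Subsingleton T.VQ]`, every toy model of the cell), by the LABELWISE assembly
`mem_closure_of_labelwise` in `⟨(Ind1) ∪ (Ind2)⟩`. What is the exact status of that one hypothesis — does X-01's dictionary language
(ONE indeterminacy for all packets: every IndTranslate / FILLS-MODULO-Y line of E-plan's X-01) say MORE than S := `PilotKummerIndRelated`
(«∀ (j, v_ℚ) ∃ possible image D′», abc-iut-w5-d230, Cor312PinnedRegionsThreePins) at a genuine, many-place index?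

ANSWER (kernel; one structural Prop, no `Prop` fact, no `sorry`):
* §1 `IndPlaceSeparable L` := «a family assembled PLACE by place from elements of `⟨(Ind1) ∪ (Ind2)⟩` lies in `⟨(Ind1) ∪ (Ind2)⟩`»;
  trivial at one place (`indPlaceSeparable_of_subsingleton`); with it, PACKETWISE assembly (`mem_closure_of_packetwise`).
* §2 **`dictionaryRealizable_iff_pilotKummerIndRelated_of_separable`**: under (hρ), X-01's hypothesis set ⟺ `UniformIndRelated` ⟺ S at
  EVERY place-separable index (p430744's one-place theorems are the case `Subsingleton T.VQ`).
* §3 WHY the hypothesis is not idle — the typed (Ind1) ([IUTchIII] Thm. 3.11 (i) p. 154 «the indeterminacies induced by the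
  automorphisms of the procession of 𝒟⊢-prime-strips»; [IUTchI] Def. 4.10, §0: a capsule-full poly-automorphism = ONE permutation of the
  index set `S^±_{j+1}`, typed verbatim in abc-iut's `LogShells.Ind1` as «ONE permutation `σ` for every `v_ℚ`») couples the places:
  the DIAGONAL capsule-permutation families `capsPermFamily σ` form a subgroup of (Ind1)-families over EVERY signature
  (`capsPermFamily_mem_Ind1Family`, `capsPermFamilyHom`; abc-iut-c312-5's one-label `LogShells.permFamily` p428608 is the case of a family supported at one label), and on a RIGID signature (strip-automorphisms and Ism trivial) they are ALL of
  `⟨(Ind1) ∪ (Ind2)⟩` (`exists_eq_permFamily_of_rigid`) — whereas (Ind2) («for each `v_ℚ` … independent copies of Ism») is a product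
  over the places.
* §4 **`TwoPlace.not_indPlaceSeparable`**: at a two-place index with permutation-DETECTING packets (`log(𝒟⊢_v) := ℚ²`, so that
  `e₀ ⊗ e₁ ⊗ e₁ ≠ e₁ ⊗ e₁ ⊗ e₀` — the linear DETECTOR `detect`), the family «identity at `v_ℚ⁰`, swap of the factors `0, j` at `v_ℚ¹`» is
  assembled place by place from members of `⟨(Ind1) ∪ (Ind2)⟩` and is not a member.
The companion `Joshi/TestDictionaryCalibrationPlacesModel.lean` instantiates S's binders there: S HOLDS, `UniformIndRelated` and
`DictionaryRealizable` FAIL (`pilotKummerIndRelated_not_imp_uniformIndRelated`) — S AS TYPED IS PACKET-LOCAL; every ONE-indeterminacy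
line (X-01's dictionary, IndTranslate) is S-OR-STRONGER, S-EQUIVALENT exactly at the place-separable indices, the excess being (Ind1)'s
diagonal capsule permutation and nothing else on rigid signatures. R9-style: «CALIBRATION (X-10) MULTI-PLACE: ⟺ at place-separable
indices (all one-place models of record); STRICTLY STRONGER at two places (kernel witness); faithfulness question for the lanes: print's
"regarded up to (Ind1), (Ind2)" is ONE indeterminacy on the whole collection (a)(b)(c) — the uniform form —, while S / R3 as typed
quantify the possible image per packet». [claim: Mochizuki2012, status: disputed] [claim: Joshi2024ATS3, status: disputed]
[cite: ScholzeStix2018, §2.2 pp. 9–10]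
-/

noncomputable section

open Set

namespace Summit.ABC.IUTFork.Joshi

open Thm311 Cor312 Cor312Vol Literature.IUT.LogThetaLattice

/-! ## 1. Place-separability of the indeterminacy subgroup -/

section Separable

variable {T : ThetaIndex} (L : LogShells T)

/-- **`IndPlaceSeparable L`** — a STRUCTURAL PROPERTY of the frozen indeterminacy signature (TEST SHAPE, never asserted): a family of
packet automorphisms assembled PLACE BY PLACE from elements of `⟨(Ind1) ∪ (Ind2)⟩` lies again in `⟨(Ind1) ∪ (Ind2)⟩` — the
place-analogue of the labelwise assembly `mem_closure_of_labelwise` (abc-iut-E-t42, p430744), which holds unconditionally because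
both families are products over the labels `j`. Across places only (Ind2) is a product ([IUTchIII] Thm. 3.11 (i) p. 154 «for each
`v_ℚ` … independent copies of Ism», `LogShells.Ind2Family`); (Ind1) («the automorphisms of the procession of 𝒟⊢-prime-strips») carries
ONE permutation of the capsule index set `S^±_{j+1}` for ALL `v_ℚ` (`LogShells.Ind1`), so the property is NOT automatic (§3).
HYPOTHESIS on the signature, never asserted; no author claims it. [claim: Mochizuki2012, status: disputed] -/
@[claim "Mochizuki2012" "disputed"]
def IndPlaceSeparable : Prop :=
  ∀ Φ : T.VQ → L.PacketAut, (∀ vQ, Φ vQ ∈ Subgroup.closure (L.Ind1Family ∪ L.Ind2Family)) →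
    (fun j vQ => Φ vQ j vQ) ∈ Subgroup.closure (L.Ind1Family ∪ L.Ind2Family)

variable {L} in
/-- Under place-separability, PACKETWISE assembly: a family assembled packet by packet — at each `(j, v_ℚ)` the component of some
element of `⟨(Ind1) ∪ (Ind2)⟩` — lies in `⟨(Ind1) ∪ (Ind2)⟩` (labelwise assembly is free, `mem_closure_of_labelwise`). [folklore] -/
theorem mem_closure_of_packetwise (hsep : IndPlaceSeparable L) (Φ : T.Label → T.VQ → L.PacketAut)
    (hΦ : ∀ j vQ, Φ j vQ ∈ Subgroup.closure (L.Ind1Family ∪ L.Ind2Family)) :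
    (fun j vQ => Φ j vQ j vQ) ∈ Subgroup.closure (L.Ind1Family ∪ L.Ind2Family) :=
  hsep (fun vQ j vQ' => Φ j vQ j vQ') fun vQ => mem_closure_of_labelwise L (fun j => Φ j vQ) fun j => hΦ j vQ

/-- **One place ⟹ place-separable** (trivially: there is nothing to assemble). Every toy index of the cell (`toyIndex`, one `v_ℚ`)
is place-separable. [folklore] -/
theorem indPlaceSeparable_of_subsingleton [Subsingleton T.VQ] : IndPlaceSeparable L := by
  intro Φ hΦ
  rcases isEmpty_or_nonempty T.VQ with hE | ⟨⟨vQ₀⟩⟩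
  · have : (fun j vQ => Φ vQ j vQ) = 1 := funext fun j => funext fun vQ => isEmptyElim vQ
    rw [this]; exact one_mem _
  · have : (fun j vQ => Φ vQ j vQ) = Φ vQ₀ := funext fun j => funext fun vQ => by
      rw [Subsingleton.elim vQ vQ₀]
    rw [this]; exact hΦ vQ₀

end Separable

/-! ## 2. The calibration at every place-separable index -/

section Calibration

variable {T : ThetaIndex} {S : LatticeSituation T} {P : Cor312.Setting S.toSituation}
  {ρ : (∀ v : T.V, v ∈ T.Vbad → Set (S.L.StarPacket v)) → ∀ (j : T.Label) (vQ : T.VQ), Set (S.L.Packet j vQ)}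
  {qK : ∀ v : T.V, v ∈ T.Vbad → Set (S.L.StarPacket v)}

/-- **S ⟹ the uniform residual at every PLACE-SEPARABLE index** (under (hρ)): S's packetwise possible images `D′_{j,v_ℚ} = Φ_{j,v_ℚ}·D_n`
assemble packet by packet into ONE `Φ ∈ ⟨(Ind1) ∪ (Ind2)⟩`. Supersedes the one-place form `uniformIndRelated_of_pilotKummerIndRelated`
(p430744), recovered through `indPlaceSeparable_of_subsingleton`. [claim: Mochizuki2012, status: disputed] -/
theorem uniformIndRelated_of_pilotKummerIndRelated_of_separable (hsep : IndPlaceSeparable S.L)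
    (hρ : ∀ Φ ∈ Subgroup.closure (S.L.Ind1Family ∪ S.L.Ind2Family),
      ∀ (Ψ : ∀ v : T.V, v ∈ T.Vbad → Set (S.L.StarPacket v)) (j : T.Label) (vQ : T.VQ),
        ρ (fun v hv => S.L.starAut Φ v '' Ψ v hv) j vQ = Φ j vQ '' ρ Ψ j vQ)
    (h : PilotKummerIndRelated S P ρ qK) : UniformIndRelated S P ρ qK := by
  choose D hD hDeq using h
  choose Φ hΦ hΦΨ using fun j vQ => GluedMonoids.exists_closure_psi_eq_of_mem_RLGP (L := S.L) (hD j vQ)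
  refine ⟨fun j vQ => Φ j vQ j vQ, mem_closure_of_packetwise hsep Φ hΦ, fun j vQ => ?_⟩
  have hDΨ : (D j vQ).Ψ = fun v hv => S.L.starAut (Φ j vQ) v '' (S.D P.n).Ψ v hv :=
    funext fun v => funext fun hv => hΦΨ j vQ v hv
  rw [hDeq j vQ, hDΨ, hρ (Φ j vQ) (hΦ j vQ)]

/-- **CALIBRATION ACROSS PLACES, I: S ⟺ the uniform residual** at every place-separable index, under (hρ).
[claim: Mochizuki2012, status: disputed] -/
theorem uniformIndRelated_iff_pilotKummerIndRelated_of_separable (hsep : IndPlaceSeparable S.L)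
    (hρ : ∀ Φ ∈ Subgroup.closure (S.L.Ind1Family ∪ S.L.Ind2Family),
      ∀ (Ψ : ∀ v : T.V, v ∈ T.Vbad → Set (S.L.StarPacket v)) (j : T.Label) (vQ : T.VQ),
        ρ (fun v hv => S.L.starAut Φ v '' Ψ v hv) j vQ = Φ j vQ '' ρ Ψ j vQ) :
    UniformIndRelated S P ρ qK ↔ PilotKummerIndRelated S P ρ qK :=
  ⟨pilotKummerIndRelated_of_uniformIndRelated hρ, uniformIndRelated_of_pilotKummerIndRelated_of_separable hsep hρ⟩

/-- **CALIBRATION ACROSS PLACES, II — `dictionaryRealizable_iff_pilotKummerIndRelated_of_separable`**: at every place-separable index,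
under (hρ), X-01's hypothesis set (`DictionaryRealizable`, p430744) is satisfiable at `(S, P, ρ, qK)` EXACTLY where S holds. The one-place
theorem `dictionaryRealizable_iff_pilotKummerIndRelated` is the case `indPlaceSeparable_of_subsingleton`. [claim: Joshi2024ATS3, status: disputed] -/
theorem dictionaryRealizable_iff_pilotKummerIndRelated_of_separable (hsep : IndPlaceSeparable S.L)
    (hρ : ∀ Φ ∈ Subgroup.closure (S.L.Ind1Family ∪ S.L.Ind2Family),
      ∀ (Ψ : ∀ v : T.V, v ∈ T.Vbad → Set (S.L.StarPacket v)) (j : T.Label) (vQ : T.VQ),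
        ρ (fun v hv => S.L.starAut Φ v '' Ψ v hv) j vQ = Φ j vQ '' ρ Ψ j vQ) :
    DictionaryRealizable S P ρ qK ↔ PilotKummerIndRelated S P ρ qK :=
  (dictionaryRealizable_iff_uniformIndRelated hρ).trans (uniformIndRelated_iff_pilotKummerIndRelated_of_separable hsep hρ)

/-- Under the two pins and Thm. 3.11 (ii)(b), at every place-separable index: X-01's hypothesis set is satisfiable ⟺ READING R3.
[claim: Mochizuki2012, status: disputed] -/
theorem dictionaryRealizable_iff_reading3_of_separable (hsep : IndPlaceSeparable S.L) (hKumB : (S.col P.n).KummerB (S.D P.n))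
    (hpin : PinnedRegions S P ρ qK) :
    DictionaryRealizable S P ρ qK ↔ ∀ (j : T.Label) (vQ : T.VQ), P.qRegion j vQ ∈ P.possibleImages j vQ :=
  (dictionaryRealizable_iff_pilotKummerIndRelated_of_separable hsep hpin.1.1).trans
    (reading3_iff_pilotKummerIndRelated S P ρ qK hKumB hpin).symm

end Calibration

/-! ## 3. Diagonal capsule permutations; rigid signatures -/

section PermFamily

variable {T : ThetaIndex} (L : LogShells T)

/-- **The DIAGONAL capsule-permutation family** of `σ = (σ_j)_j`: at every `(j, v_ℚ)` permute the tensor factors of the packet by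
`σ_j` — the SAME permutation of `S^±_{j+1}` at EVERY place, as in (Ind1) ([IUTchIII] Thm. 3.11 (i) p. 154; `LogShells.Ind1`). [folklore] -/
def _root_.Summit.ABC.IUTFork.Thm311.LogShells.capsPermFamily (σ : ∀ j : T.Label, Equiv.Perm (T.Caps j)) : L.PacketAut :=
  fun j vQ => L.permute j vQ (σ j)

/-- The diagonal capsule-permutation families form the image of a group homomorphism `∏_j Perm(S^±_{j+1}) → PacketAut`. [folklore] -/
def _root_.Summit.ABC.IUTFork.Thm311.LogShells.capsPermFamilyHom : (∀ j : T.Label, Equiv.Perm (T.Caps j)) →* L.PacketAut where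
  toFun := L.capsPermFamily
  map_one' := funext fun j => funext fun vQ => L.permute_refl j vQ
  map_mul' σ τ := funext fun j => funext fun vQ => L.permute_mul j vQ (σ j) (τ j)

/-- **Every diagonal capsule-permutation family is an (Ind1)-family** (strip-automorphisms all trivial; `one_mem_stripAut`) — over
EVERY signature `L`. [claim: Mochizuki2012, status: disputed] -/
theorem _root_.Summit.ABC.IUTFork.Thm311.LogShells.capsPermFamily_mem_Ind1Family (σ : ∀ j : T.Label, Equiv.Perm (T.Caps j)) :
    L.capsPermFamily σ ∈ L.Ind1Family := fun j =>
  ⟨σ j, fun _ v => LinearEquiv.refl ℚ (L.carrier v), fun _ v => L.one_mem_stripAut v, fun vQ => by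
    rw [L.summandwise_refl_family, L.factorwise_refl, LinearEquiv.trans_refl]; rfl⟩

/-- … hence lies in `⟨(Ind1) ∪ (Ind2)⟩`. [folklore] -/
theorem _root_.Summit.ABC.IUTFork.Thm311.LogShells.capsPermFamily_mem_closure (σ : ∀ j : T.Label, Equiv.Perm (T.Caps j)) :
    L.capsPermFamily σ ∈ Subgroup.closure (L.Ind1Family ∪ L.Ind2Family) :=
  Subgroup.subset_closure (Or.inl (L.capsPermFamily_mem_Ind1Family σ))

/-- **`Rigid L`** — a signature whose strip-automorphisms and Ism are BOTH reduced to the identity (TEST SHAPE on the signature; the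
cell's `toyShells`/`lineShells` are rigid). On a rigid signature (Ind2) is trivial and (Ind1) is exactly the diagonal capsule
permutations, so the only coupling the indeterminacies carry is (Ind1)'s «one permutation for all `v_ℚ`». TEST SHAPE, never
asserted; no author claims it. [claim: Mochizuki2012, status: disputed] -/
@[claim "Mochizuki2012" "disputed"]
def _root_.Summit.ABC.IUTFork.Thm311.LogShells.Rigid : Prop :=
  ∀ v, L.stripAut v = {LinearEquiv.refl ℚ (L.carrier v)} ∧ L.ism v = {LinearEquiv.refl ℚ (L.carrier v)}

variable {L}

/-- On a rigid signature every (Ind2)-automorphism is the identity. [folklore] -/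
theorem _root_.Summit.ABC.IUTFork.Thm311.LogShells.eq_refl_of_mem_Ind2_of_rigid (hL : L.Rigid) {j : T.Label} {vQ : T.VQ}
    {φ : L.Packet j vQ ≃ₗ[ℚ] L.Packet j vQ} (hφ : φ ∈ L.Ind2 j vQ) : φ = LinearEquiv.refl ℚ _ := by
  obtain ⟨g, hg, rfl⟩ := hφ
  have hg' : g = fun (_ : T.Caps j) (v : T.Fibre vQ) => LinearEquiv.refl ℚ (L.carrier v.1) :=
      funext fun i => funext fun v => by
    have h := hg i v
    rw [(hL v.1).2] at h
    exact h
  rw [hg', L.summandwise_refl_family, L.factorwise_refl]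

/-- On a rigid signature every (Ind1)-family at label `j` is `v_ℚ ↦ permute σ` for ONE `σ ∈ Perm(S^±_{j+1})`. [folklore] -/
theorem _root_.Summit.ABC.IUTFork.Thm311.LogShells.exists_perm_of_mem_Ind1_of_rigid (hL : L.Rigid) {j : T.Label}
    {Φ : ∀ vQ : T.VQ, L.Packet j vQ ≃ₗ[ℚ] L.Packet j vQ} (hΦ : Φ ∈ L.Ind1 j) :
    ∃ σ : Equiv.Perm (T.Caps j), ∀ vQ, Φ vQ = L.permute j vQ σ := by
  obtain ⟨σ, h, hh, hΦ⟩ := hΦ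
  refine ⟨σ, fun vQ => ?_⟩
  have hh' : h = fun (_ : T.Caps j) (v : T.V) => LinearEquiv.refl ℚ (L.carrier v) := funext fun i => funext fun v => by
    have h1 := hh i v
    rw [(hL v).1] at h1
    exact h1
  rw [hΦ vQ, hh', L.summandwise_refl_family, L.factorwise_refl, LinearEquiv.trans_refl]

/-- **On a rigid signature `⟨(Ind1) ∪ (Ind2)⟩` consists of diagonal capsule-permutation families** (it is contained in the range of
`capsPermFamilyHom`; the reverse inclusion is `capsPermFamily_mem_closure`). [folklore] -/
theorem _root_.Summit.ABC.IUTFork.Thm311.LogShells.closure_le_range_capsPermFamilyHom (hL : L.Rigid) :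
    Subgroup.closure (L.Ind1Family ∪ L.Ind2Family) ≤ L.capsPermFamilyHom.range := by
  rw [Subgroup.closure_le]
  rintro Φ (h1 | h2)
  · choose σ hσ using fun j => L.exists_perm_of_mem_Ind1_of_rigid hL (h1 j)
    exact ⟨σ, funext fun j => funext fun vQ => (hσ j vQ).symm⟩
  · refine ⟨1, ?_⟩
    rw [map_one]
    exact (funext fun j => funext fun vQ => L.eq_refl_of_mem_Ind2_of_rigid hL (h2 j vQ) :
      Φ = fun j vQ => LinearEquiv.refl ℚ _).symm

/-- On a rigid signature, every element of `⟨(Ind1) ∪ (Ind2)⟩` IS a diagonal capsule-permutation family. [folklore] -/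
theorem _root_.Summit.ABC.IUTFork.Thm311.LogShells.exists_eq_permFamily_of_rigid (hL : L.Rigid) {Φ : L.PacketAut}
    (hΦ : Φ ∈ Subgroup.closure (L.Ind1Family ∪ L.Ind2Family)) :
    ∃ σ : ∀ j : T.Label, Equiv.Perm (T.Caps j), Φ = L.capsPermFamily σ := by
  obtain ⟨σ, hσ⟩ := L.closure_le_range_capsPermFamilyHom hL hΦ
  exact ⟨σ, hσ.symm⟩

end PermFamily

/-! ## 4. The two-place index with permutation-detecting packets: `⟨(Ind1) ∪ (Ind2)⟩` is not place-separable -/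

namespace TwoPlace

/-- **A TWO-PLACE index skeleton**: `l⋇ = 2`, two valuations `V = {v₀, v₁}` over two places `V_ℚ = {v_ℚ⁰, v_ℚ¹}` (one each), all
nonarchimedean and bad. Interface/toy index (as `toyIndex`, but with TWO places). [folklore] -/
def index : ThetaIndex where
  lstar := 2
  two_le_lstar := le_rfl
  V := Bool
  VQ := Bool
  over := id
  IsNon := fun _ => True
  fibre_finite := fun _ => Set.toFinite _
  fibre_nonempty := fun vQ => ⟨vQ, rfl⟩
  Vbad := Set.univ
  Vbad_nonempty := ⟨true, trivial⟩
  Vbad_finite := Set.toFinite _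
  Vbad_non := fun _ _ => trivial

/-- The valuation over the place `v_ℚ` (the fibres are singletons). [folklore] -/
def pt (vQ : index.VQ) : index.Fibre vQ := ⟨vQ, rfl⟩

/-- **Permutation-detecting shells**: `log(𝒟⊢_v) := ℚ²` at both valuations (so that the `(j+1)`-tensor packets SEE permutations of
their factors), the log-shell all of it, strip-automorphisms and Ism reduced to the identity (a RIGID signature). [folklore] -/
def shells : LogShells index where
  carrier := fun _ => Fin 2 → ℚ
  shell := fun _ => Set.univ
  stripAut := fun _ => {LinearEquiv.refl ℚ _}
  ism := fun _ => {LinearEquiv.refl ℚ _}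
  one_mem_stripAut := fun _ => rfl
  one_mem_ism := fun _ => rfl

/-- The shells are rigid. [folklore] -/
theorem shells_rigid : shells.Rigid := fun _ => ⟨rfl, rfl⟩

/-- The two basis vectors `e_c` (`c = 0, 1`) of `log(𝒟⊢_{v_ℚ}) = ℚ²`, as elements of the 1-tensor packet. [folklore] -/
def E (vQ : index.VQ) (c : Fin 2) : shells.Packet1 vQ := fun _ => Pi.single c 1

/-- The NON-SYMMETRIC pure tensor `x₀ = e₀ ⊗ e₁ ⊗ ⋯ ⊗ e₁` (factor `0` carries `e₀`, every other factor `e₁`), as a family of factors. [folklore] -/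
def x0 (j : index.Label) (vQ : index.VQ) : index.Caps j → shells.Packet1 vQ :=
  fun k => if k = 0 then E vQ 0 else E vQ 1

/-- The pure tensor `t₀ := e₀ ⊗ e₁ ⊗ ⋯ ⊗ e₁` of the `(j+1)`-tensor packet at `v_ℚ`. [folklore] -/
def t0 (j : index.Label) (vQ : index.VQ) : shells.Packet j vQ := shells.tprod j vQ (x0 j vQ)

/-- The coordinate functional reading, on factor `k`, the coordinate `0` if `k = 0` and the coordinate `1` otherwise. [folklore] -/
def coordFun (j : index.Label) (vQ : index.VQ) (k : index.Caps j) : shells.Packet1 vQ →ₗ[ℚ] ℚ :=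
  (LinearMap.proj (if k = 0 then (0 : Fin 2) else 1) : (Fin 2 → ℚ) →ₗ[ℚ] ℚ) ∘ₗ
    (LinearMap.proj (pt vQ) : shells.Packet1 vQ →ₗ[ℚ] (Fin 2 → ℚ))

/-- **The permutation DETECTOR**: the linear functional `⊗_k y_k ↦ ∏_k coordFun_k(y_k)` of the `(j+1)`-tensor packet. [folklore] -/
def detect (j : index.Label) (vQ : index.VQ) : shells.Packet j vQ →ₗ[ℚ] ℚ :=
  (PiTensorProduct.constantBaseRingEquiv (index.Caps j) ℚ).toLinearEquiv.toLinearMap ∘ₗ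
    PiTensorProduct.map fun k : index.Caps j => coordFun j vQ k

/-- The detector on a pure tensor is the product of the factor coordinates. [folklore] -/
theorem detect_tprod (j : index.Label) (vQ : index.VQ) (x : index.Caps j → shells.Packet1 vQ) :
    detect j vQ (shells.tprod j vQ x) = ∏ k, x k (pt vQ) (if k = 0 then 0 else 1) := by
  unfold detect LogShells.tprod
  rw [LinearMap.comp_apply]
  erw [PiTensorProduct.map_tprod]
  change (PiTensorProduct.constantBaseRingEquiv (index.Caps j) ℚ)
      (PiTensorProduct.tprod ℚ fun k : index.Caps j => coordFun j vQ k (x k)) = _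
  rw [PiTensorProduct.constantBaseRingEquiv_tprod]
  rfl

/-- The detector reads `1` on `t₀`. [folklore] -/
theorem detect_t0 (j : index.Label) (vQ : index.VQ) : detect j vQ (t0 j vQ) = 1 := by
  unfold t0
  rw [detect_tprod]
  refine Finset.prod_eq_one fun k _ => ?_
  unfold x0 E
  split_ifs <;> simp

/-- The detector reads `0` on `t₀` with its factors permuted by any `σ` MOVING the factor `0`. [folklore] -/
theorem detect_permute_t0 (j : index.Label) (vQ : index.VQ) {σ : Equiv.Perm (index.Caps j)} (hσ : σ 0 ≠ 0) :
    detect j vQ (shells.permute j vQ σ (t0 j vQ)) = 0 := by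
  unfold t0
  rw [shells.permute_tprod, detect_tprod]
  refine Finset.prod_eq_zero (Finset.mem_univ (0 : index.Caps j)) ?_
  have h0 : σ.symm 0 ≠ 0 := fun h => hσ (by simpa using (congrArg σ h).symm)
  simp [x0, E, h0]

/-- **A permutation fixing the factor `0` fixes `t₀`** (the other factors all carry `e₁`). [folklore] -/
theorem permute_t0_of_fix (j : index.Label) (vQ : index.VQ) {σ : Equiv.Perm (index.Caps j)} (hσ : σ 0 = 0) :
    shells.permute j vQ σ (t0 j vQ) = t0 j vQ := by
  unfold t0
  rw [shells.permute_tprod]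
  congr 1
  funext k
  have hk : σ.symm k = 0 ↔ k = 0 := by
    rw [Equiv.symm_apply_eq]; exact ⟨fun h => h.trans hσ, fun h => h.trans hσ.symm⟩
  simp only [x0, hk]

/-- **A permutation moving the factor `0` MOVES `t₀`** (the detector reads `0 ≠ 1`). [folklore] -/
theorem permute_t0_ne_of_not_fix (j : index.Label) (vQ : index.VQ) {σ : Equiv.Perm (index.Caps j)} (hσ : σ 0 ≠ 0) :
    shells.permute j vQ σ (t0 j vQ) ≠ t0 j vQ := fun h => by
  have h1 := detect_permute_t0 j vQ hσ
  rw [h, detect_t0] at h1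
  exact one_ne_zero h1

/-- The TOP label `j⋆ = l⋇ = 2` (its capsule `S^±_3` has three elements). [folklore] -/
def jTop : index.Label := Fin.last 2

/-- The swap of the factors `0` and `j` of the `(j+1)`-capsule. [folklore] -/
def sw (j : index.Label) : Equiv.Perm (index.Caps j) := Equiv.swap 0 (Fin.last _)

/-- At the top label the swap moves the factor `0`. [folklore] -/
theorem sw_jTop_zero_ne : sw jTop 0 ≠ 0 := by
  unfold sw
  rw [Equiv.swap_apply_left]
  decide

/-- **The PLACE WITNESS**: the identity family at the place `v_ℚ⁰ = false`, the diagonal swap family at `v_ℚ¹ = true` — each in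
`⟨(Ind1) ∪ (Ind2)⟩`. [folklore] -/
def placeWitness (b : Bool) : shells.PacketAut := bif b then shells.capsPermFamily sw else 1

/-- Each place's family lies in `⟨(Ind1) ∪ (Ind2)⟩`. [folklore] -/
theorem placeWitness_mem (b : Bool) : placeWitness b ∈ Subgroup.closure (shells.Ind1Family ∪ shells.Ind2Family) := by
  cases b
  · exact one_mem _
  · exact shells.capsPermFamily_mem_closure sw

/-- **The MIXED family**: identity at `v_ℚ⁰`, swap at `v_ℚ¹` — assembled place by place from `placeWitness`. [folklore] -/
def mixed : shells.PacketAut := fun j vQ => placeWitness vQ j vQ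

/-- At `v_ℚ⁰` the mixed family is the identity. [folklore] -/
theorem mixed_false (j : index.Label) : mixed j false = LinearEquiv.refl ℚ _ := rfl

/-- At `v_ℚ¹` the mixed family is the swap. [folklore] -/
theorem mixed_true (j : index.Label) : mixed j true = shells.permute j true (sw j) := rfl

/-- **The mixed family is NOT in `⟨(Ind1) ∪ (Ind2)⟩`**: an element of the subgroup is a diagonal capsule permutation `σ`; at `v_ℚ⁰`
it would fix `t₀` (so `σ_{j⋆}` fixes the factor `0`), at `v_ℚ¹` it would move `t₀` as the swap does — impossible. [folklore] -/
theorem mixed_not_mem : mixed ∉ Subgroup.closure (shells.Ind1Family ∪ shells.Ind2Family) := fun hmem => by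
  obtain ⟨σ, hσ⟩ := shells.exists_eq_permFamily_of_rigid shells_rigid hmem
  have h0 : shells.permute jTop false (σ jTop) = LinearEquiv.refl ℚ _ :=
    ((congrFun (congrFun hσ jTop) false).symm).trans (mixed_false jTop)
  have hfix : σ jTop 0 = 0 := by
    by_contra h
    exact permute_t0_ne_of_not_fix jTop false h (by rw [h0]; rfl)
  have h1 : shells.permute jTop true (sw jTop) = shells.permute jTop true (σ jTop) :=
    (mixed_true jTop).symm.trans (congrFun (congrFun hσ jTop) true)
  refine permute_t0_ne_of_not_fix jTop true sw_jTop_zero_ne ?_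
  rw [h1]
  exact permute_t0_of_fix jTop true hfix

/-- **`not_indPlaceSeparable` — (Ind1)'s DIAGONAL CAPSULE PERMUTATION OBSTRUCTS PLACE-SEPARABILITY**: at the two-place index with
permutation-detecting packets, `⟨(Ind1) ∪ (Ind2)⟩` is NOT place-separable (the mixed family is assembled place by place from members
and is not a member). So `IndPlaceSeparable` is a genuine hypothesis of §2, not a tautology. [claim: Mochizuki2012, status: disputed] -/
theorem not_indPlaceSeparable : ¬ IndPlaceSeparable shells := fun hsep =>
  mixed_not_mem (hsep (fun vQ => placeWitness vQ) placeWitness_mem)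

end TwoPlace

end Summit.ABC.IUTFork.Joshi

end
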